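import Mathlib.Analysis.SpecialFunctions.Pow.Real

/-!
HONEST FRAMING: exact (Metropolis-corrected) sampling algorithms for lattice gauge theory; figures
of merit are autocorrelation/cost numbers at stated couplings and volumes; no continuum-physics
claim.

# StarPersistenceWeights — THE THREE SCALAR INEQUALITIES OF THE ADDITIVE CERTIFICATE HOLD FOR THE PERSISTENCE WEIGHT `G(u,v) = γ·max{W(u), W(v)}`
# (`W = μ_1/μ_0`), HUB-PAIR DEBT `E = λG`, `λ(1 − 2σ) = 1`, `σ ≤ 1/4` (lean-2 GEN-34, ours)

Venture-side (OURS).  Cell `lqcd-flow` (pub-lqcd), unit `pub-lqcd-lean-2-g34`, 2026-08-29.  Chapter U, file 2 (pure real algebra; no chain).  For a positive weight `W : S → ℝ` (in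
file 3: the cold/hot likelihood ratio `μ_1/μ_0`, the PERSISTENCE of a content at a cold level), acceptances `acc(x,u) = min{1, W(x)/W(u)}` (hub content `x` offered to a
level holding `u`), level-pair cost `G(u,v) = γ·max{W(u),W(v)}` for `u ≠ v` (`G(u,u) = 0`, `γ > 0`) — a disagreement costs the persistence of the MORE persistent of its two
contents (the shape memo-33 §5 read off the Perron vector) — and hub-pair debt `E = λ·G`, the quantities of `StarAdditiveCertificate` satisfy:

* (N) `net(z;u,v) ≥ (1 − 2σλ)·G(u,v)·min{acc(z,u), acc(z,v)}` (`persist_net_ge`) — non-negative once `σλ ≤ 1/2`: a one-sided acceptance at a disagreeing level never raises the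
  level's cost (the more persistent content stays) and the hub pair it creates is worth at most the healing credit of the same attempt (`persist_excess_mul_cost_le`);
* (D) the one-attempt debt inequality with `E = λG` whenever `λ = 1 + 2σλ` (`persist_debt_le`): a disagreeing hub pair `(a,b)` spreads at most its own cost `max{W(a),W(b)}` per
  attempt — pushing `b` into a level holding a more persistent `t` happens with probability `W(b)/W(t)` and costs `W(t)` (`persist_accept_mul_cost_le_left` ∕ `_right`);
* (R) `Σ_z μ_0(z)·net(z;u,v) ≥ (1 − 2σλ)·p·G(u,v)` under `μ_0·W = μ_1`, `Σ μ_1 = 1` and the domination `p·W ≤ 1` (`persist_redraw_ge`): after a shared redraw the healing swap of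
  a disagreeing level is accepted in both copies with mean probability `≥ p` (the `q`-content form of `BooleanStarAveragedDrift`).

Hypothesis-equations throughout; no definitions.  NOT CLAIMED: anything about the chain (file 3 assembles).  Literature grade (cell rule): OWN, elementary; nothing cited as a
fact; no new bib keys.
-/

noncomputable section
open Finset

namespace Summit.Ventures.LatticeQCDFlow.Scaling

section Weights
variable {S : Type*} [DecidableEq S] {W : S → ℝ} {acc G E : S → S → ℝ} {net : S → S → S → ℝ} {γ σ lam : ℝ}

/-! ## §1 Acceptances and costs -/

omit [DecidableEq S] in
/-- `0 ≤ acc ≤ 1`. [ours] -/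
theorem persist_acc_mem (hW : ∀ u, 0 < W u) (hacc : ∀ x u, acc x u = min 1 (W x / W u)) (x u : S) : 0 ≤ acc x u ∧ acc x u ≤ 1 := by
  rw [hacc]; exact ⟨le_min zero_le_one (div_nonneg (hW x).le (hW u).le), min_le_left _ _⟩

omit [DecidableEq S] in
/-- A content at least as persistent as the level's is always accepted. [ours] -/
theorem persist_acc_eq_one (hW : ∀ u, 0 < W u) (hacc : ∀ x u, acc x u = min 1 (W x / W u)) {x u : S} (h : W u ≤ W x) : acc x u = 1 := by
  rw [hacc]; exact min_eq_left ((one_le_div (hW u)).mpr h)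

omit [DecidableEq S] in
/-- A less persistent content is accepted with probability `W(x)/W(u)`. [ours] -/
theorem persist_acc_eq_div (hW : ∀ u, 0 < W u) (hacc : ∀ x u, acc x u = min 1 (W x / W u)) {x u : S} (h : W x ≤ W u) : acc x u = W x / W u := by
  rw [hacc]; exact min_eq_right ((div_le_one (hW u)).mpr h)

omit [DecidableEq S] in
/-- `acc(x,u)·W(u) ≤ W(x)`. [ours] -/
theorem persist_acc_mul_le (hW : ∀ u, 0 < W u) (hacc : ∀ x u, acc x u = min 1 (W x / W u)) (x u : S) : acc x u * W u ≤ W x := by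
  have h := min_le_right 1 (W x / W u)
  rw [← hacc] at h
  calc acc x u * W u ≤ W x / W u * W u := mul_le_mul_of_nonneg_right h (hW u).le
    _ = W x := div_mul_cancel₀ _ (hW u).ne'

omit [DecidableEq S] in
/-- Acceptance into a more persistent level is harder: `W(u) ≤ W(v) ⇒ acc(z,v) ≤ acc(z,u)`. [ours] -/
theorem persist_acc_anti (hW : ∀ u, 0 < W u) (hacc : ∀ x u, acc x u = min 1 (W x / W u)) (z : S) {u v : S} (h : W u ≤ W v) : acc z v ≤ acc z u := by
  rw [hacc, hacc]; exact min_le_min le_rfl (div_le_div_of_nonneg_left (hW z).le (hW u) h)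

/-- `G ≥ 0`, `G(u,u) = 0`, `G` symmetric, `G(u,v) = γ·max` off the diagonal, `G ≤ γ·W_max`. [ours] -/
theorem persist_cost_basic (hW : ∀ u, 0 < W u) (hγ : 0 < γ) (hG : ∀ u v, G u v = if u = v then 0 else γ * max (W u) (W v)) :
    (∀ u v, 0 ≤ G u v) ∧ (∀ u, G u u = 0) ∧ (∀ u v, G u v = G v u) ∧ (∀ u v, u ≠ v → G u v = γ * max (W u) (W v))
      ∧ (∀ u v, G u v ≤ γ * max (W u) (W v)) := by
  refine ⟨fun u v => ?_, fun u => by rw [hG, if_pos rfl], fun u v => ?_, fun u v h => by rw [hG, if_neg h], fun u v => ?_⟩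
  · rw [hG]; split_ifs
    · exact le_rfl
    · exact mul_nonneg hγ.le ((hW u).le.trans (le_max_left _ _))
  · rw [hG, hG, max_comm]
    by_cases h : u = v
    · subst h; rfl
    · rw [if_neg h, if_neg (Ne.symm h)]
  · rw [hG]; split_ifs
    · exact mul_nonneg hγ.le ((hW u).le.trans (le_max_left _ _))
    · exact le_rfl

/-! ## §2 (N): the one-attempt net gain of a disagreeing level -/

/-- **A one-sided acceptance never changes the level's cost** (`W(u) ≤ W(v)`): `(acc(z,u) − acc(z,v))·(G(z,v) − G(u,v)) = 0` — either `z` is at least as persistent as `v` (both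
copies accept) or the new pair `(z,v)` again costs `W(v)`. [ours] -/
theorem persist_excess_mul_shift_eq_zero (hW : ∀ u, 0 < W u) (hacc : ∀ x u, acc x u = min 1 (W x / W u)) (hγ : 0 < γ)
    (hG : ∀ u v, G u v = if u = v then 0 else γ * max (W u) (W v)) (z : S) {u v : S} (huv : W u ≤ W v) :
    (acc z u - acc z v) * (G z v - G u v) = 0 := by
  obtain ⟨_, hGd, _, hGne, _⟩ := persist_cost_basic hW hγ hG
  by_cases h : u = v
  · subst h; rw [sub_self, zero_mul]
  rcases le_or_gt (W v) (W z) with hzv | hzv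
  · rw [persist_acc_eq_one hW hacc hzv, persist_acc_eq_one hW hacc (huv.trans hzv), sub_self, zero_mul]
  · have hne : z ≠ v := fun e => by rw [e] at hzv; exact lt_irrefl _ hzv
    rw [hGne z v hne, hGne u v h, max_eq_right hzv.le, max_eq_right huv, sub_self, mul_zero]

/-- **The hub pair created by a one-sided acceptance is worth at most the healing credit** (`W(u) ≤ W(v)`): `(acc(z,u) − acc(z,v))·G(u,z) ≤ acc(z,v)·G(u,v)`. [ours] -/
theorem persist_excess_mul_cost_le (hW : ∀ u, 0 < W u) (hacc : ∀ x u, acc x u = min 1 (W x / W u)) (hγ : 0 < γ)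
    (hG : ∀ u v, G u v = if u = v then 0 else γ * max (W u) (W v)) (z : S) {u v : S} (huv : W u ≤ W v) :
    (acc z u - acc z v) * G u z ≤ acc z v * G u v := by
  obtain ⟨hG0, hGd, _, hGne, _⟩ := persist_cost_basic hW hγ hG
  have hav := (persist_acc_mem hW hacc z v).1
  by_cases h : u = v
  · subst h; rw [sub_self, zero_mul]; exact mul_nonneg hav (hG0 _ _)
  by_cases hzu : u = z
  · rw [hzu, hGd, mul_zero]; exact mul_nonneg hav (hG0 _ _)
  rw [hGne u z hzu, hGne u v h, max_eq_right huv]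
  rcases le_or_gt (W v) (W z) with hzv | hzv
  · rw [persist_acc_eq_one hW hacc hzv, persist_acc_eq_one hW hacc (huv.trans hzv), sub_self, zero_mul, one_mul]
    exact mul_nonneg hγ.le (hW v).le
  rw [persist_acc_eq_div hW hacc hzv.le]
  have hv0 : W v ≠ 0 := (hW v).ne'
  have hu0 : W u ≠ 0 := (hW u).ne'
  have h2 : W z / W v * (γ * W v) = γ * W z := by field_simp
  rcases le_or_gt (W u) (W z) with hzu' | hzu'
  · -- `W u ≤ W z < W v`: `(1 − W z/W v)·γ W z ≤ γ W z = (W z/W v)·γ W v`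
    rw [persist_acc_eq_one hW hacc hzu', max_eq_right hzu', h2]
    have h3 : 0 ≤ W z / W v := div_nonneg (hW z).le (hW v).le
    nlinarith [mul_nonneg h3 (mul_nonneg hγ.le (hW z).le)]
  · -- `W z < W u ≤ W v`: `(W z/W u − W z/W v)·γ W u = γ W z (1 − W u/W v) ≤ γ W z`
    rw [persist_acc_eq_div hW hacc hzu'.le, max_eq_left hzu'.le, h2]
    have h1 : (W z / W u - W z / W v) * (γ * W u) = γ * W z - γ * W z * (W u / W v) := by field_simp
    rw [h1]
    nlinarith [mul_nonneg (mul_nonneg hγ.le (hW z).le) (div_nonneg (hW u).le (hW v).le)]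

omit [DecidableEq S] in
/-- `net` is symmetric in the level pair (as are `G` and `E`). [ours] -/
theorem persist_net_symm (hGs : ∀ u v, G u v = G v u) (hEs : ∀ u v, E u v = E v u)
    (hnet : ∀ z u v, net z u v = min (acc z u) (acc z v) * (G u v - σ * E u v)
      - (acc z u - min (acc z u) (acc z v)) * (G z v - G u v + σ * E u z) - (acc z v - min (acc z u) (acc z v)) * (G u z - G u v + σ * E z v))
    (z u v : S) : net z u v = net z v u := by
  rw [hnet, hnet, min_comm (acc z v) (acc z u), hGs v u, hEs v u, hGs z u, hGs v z, hEs v z, hEs u z, hGs z v]; ring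

/-- **(N) THE ONE-ATTEMPT NET GAIN IS A FIXED FRACTION OF THE HEALING CREDIT:** `net(z;u,v) ≥ (1 − 2σλ)·G(u,v)·min{acc(z,u), acc(z,v)}` for `G = γ·max W`, `E = λG`, `σ, λ ≥ 0`. [ours] -/
theorem persist_net_ge (hW : ∀ u, 0 < W u) (hacc : ∀ x u, acc x u = min 1 (W x / W u)) (hγ : 0 < γ)
    (hG : ∀ u v, G u v = if u = v then 0 else γ * max (W u) (W v)) (hE : ∀ u v, E u v = lam * G u v) (hσ0 : 0 ≤ σ) (hlam0 : 0 ≤ lam)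
    (hnet : ∀ z u v, net z u v = min (acc z u) (acc z v) * (G u v - σ * E u v)
      - (acc z u - min (acc z u) (acc z v)) * (G z v - G u v + σ * E u z) - (acc z v - min (acc z u) (acc z v)) * (G u z - G u v + σ * E z v))
    (z u v : S) : (1 - 2 * (σ * lam)) * G u v * min (acc z u) (acc z v) ≤ net z u v := by
  obtain ⟨hG0, hGd, hGs, hGne, _⟩ := persist_cost_basic hW hγ hG
  have hEs : ∀ u v, E u v = E v u := fun u v => by rw [hE, hE, hGs]
  -- reduce to `W u ≤ W v` by symmetry
  wlog huv : W u ≤ W v generalizing u v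
  · have h := this v u (le_of_not_ge huv)
    rw [persist_net_symm hGs hEs hnet z v u, hGs v u, min_comm] at h
    exact h
  have hanti := persist_acc_anti hW hacc z huv
  rw [hnet, min_eq_right hanti, sub_self, zero_mul, sub_zero, hE u v, hE u z]
  have h1 := persist_excess_mul_shift_eq_zero hW hacc hγ hG z huv
  have h2 := persist_excess_mul_cost_le hW hacc hγ hG z huv
  have h3 : 0 ≤ acc z u - acc z v := sub_nonneg.mpr hanti
  have hσl : 0 ≤ σ * lam := mul_nonneg hσ0 hlam0
  nlinarith [mul_nonneg hσl (mul_nonneg (persist_acc_mem hW hacc z v).1 (hG0 u v)), mul_le_mul_of_nonneg_left h2 hσl]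

/-! ## §3 (D): the one-attempt debt of a disagreeing hub pair -/

/-- Offering `a` to a level holding `s` and pairing the ejected `s` with `b` costs at most `G(a,b)` in expectation: `acc(a,s)·G(s,b) ≤ G(a,b)` (`W(a) ≤ W(b)`, `a ≠ b`). [ours] -/
theorem persist_accept_mul_cost_le_left (hW : ∀ u, 0 < W u) (hacc : ∀ x u, acc x u = min 1 (W x / W u)) (hγ : 0 < γ)
    (hG : ∀ u v, G u v = if u = v then 0 else γ * max (W u) (W v)) {a b : S} (hab : a ≠ b) (hWab : W a ≤ W b) (s : S) :
    acc a s * G s b ≤ G a b := by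
  obtain ⟨hG0, hGd, _, hGne, _⟩ := persist_cost_basic hW hγ hG
  obtain ⟨ha0, ha1⟩ := persist_acc_mem hW hacc a s
  rw [hGne a b hab, max_eq_right hWab]
  by_cases hsb : s = b
  · rw [hsb, hGd, mul_zero]; exact mul_nonneg hγ.le (hW b).le
  rw [hGne s b hsb]
  rcases le_or_gt (W s) (W b) with h | h
  · rw [max_eq_right h]; nlinarith [mul_nonneg hγ.le (hW b).le]
  · rw [max_eq_left h.le]
    have := persist_acc_mul_le hW hacc a s
    nlinarith

/-- `acc(b,t)·G(a,t) ≤ G(a,b)` (`W(a) ≤ W(b)`, `a ≠ b`): pushing `b` into a more persistent level `t` happens with probability `W(b)/W(t)` and costs `W(t)`. [ours] -/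
theorem persist_accept_mul_cost_le_right (hW : ∀ u, 0 < W u) (hacc : ∀ x u, acc x u = min 1 (W x / W u)) (hγ : 0 < γ)
    (hG : ∀ u v, G u v = if u = v then 0 else γ * max (W u) (W v)) {a b : S} (hab : a ≠ b) (hWab : W a ≤ W b) (t : S) :
    acc b t * G a t ≤ G a b := by
  obtain ⟨hG0, hGd, _, hGne, _⟩ := persist_cost_basic hW hγ hG
  obtain ⟨hb0, hb1⟩ := persist_acc_mem hW hacc b t
  rw [hGne a b hab, max_eq_right hWab]
  by_cases hat : a = t
  · rw [hat, hGd, mul_zero]; exact mul_nonneg hγ.le (hW b).le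
  rw [hGne a t hat]
  rcases le_or_gt (W t) (W b) with h | h
  · have h2 : γ * max (W a) (W t) ≤ γ * W b := mul_le_mul_of_nonneg_left (max_le hWab h) hγ.le
    have h3 : 0 ≤ γ * max (W a) (W t) := mul_nonneg hγ.le ((hW a).le.trans (le_max_left _ _))
    nlinarith
  · rw [max_eq_right (hWab.trans h.le)]
    have := persist_acc_mul_le hW hacc b t
    nlinarith

omit [DecidableEq S] in
/-- The debt expression is invariant under exchanging the copies: `(a,s) ↔ (b,t)`. [ours] -/
theorem persist_debt_symm (hGs : ∀ u v, G u v = G v u) (hEs : ∀ u v, E u v = E v u) (a b s t : S) :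
    min (acc a s) (acc b t) * (G a b - G s t + σ * E s t) + (acc a s - min (acc a s) (acc b t)) * (G a t - G s t + σ * E s b)
        + (acc b t - min (acc a s) (acc b t)) * (G s b - G s t + σ * E a t) + (1 - acc a s - acc b t + min (acc a s) (acc b t)) * (σ * E a b)
      = min (acc b t) (acc a s) * (G b a - G t s + σ * E t s) + (acc b t - min (acc b t) (acc a s)) * (G b s - G t s + σ * E t a)
        + (acc a s - min (acc b t) (acc a s)) * (G t a - G t s + σ * E b s) + (1 - acc b t - acc a s + min (acc b t) (acc a s)) * (σ * E b a) := by
  rw [min_comm (acc b t), hGs b a, hGs t s, hEs t s, hGs b s, hEs t a, hGs t a, hEs b s, hEs b a]; ring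

/-- **(D) THE ONE-ATTEMPT DEBT INEQUALITY** for `G = γ·max W`, `E = λG` with `λ = 1 + 2σλ` (i.e. `λ(1−2σ) = 1`), `0 ≤ σλ ≤ 1`: at a disagreeing hub pair `(a,b)` and any level type
`(s,t)`, the expected new cost plus carried debt after one attempt is at most `E(a,b)`. [ours] -/
theorem persist_debt_le (hW : ∀ u, 0 < W u) (hacc : ∀ x u, acc x u = min 1 (W x / W u)) (hγ : 0 < γ)
    (hG : ∀ u v, G u v = if u = v then 0 else γ * max (W u) (W v)) (hE : ∀ u v, E u v = lam * G u v) (hσ0 : 0 ≤ σ)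
    (hlam0 : 0 ≤ lam) (hlam : lam = 1 + 2 * (σ * lam)) (hσl1 : σ * lam ≤ 1) {a b : S} (hab : a ≠ b) (s t : S) :
    min (acc a s) (acc b t) * (G a b - G s t + σ * E s t) + (acc a s - min (acc a s) (acc b t)) * (G a t - G s t + σ * E s b)
        + (acc b t - min (acc a s) (acc b t)) * (G s b - G s t + σ * E a t) + (1 - acc a s - acc b t + min (acc a s) (acc b t)) * (σ * E a b)
      ≤ E a b := by
  obtain ⟨hG0, hGd, hGs, hGne, _⟩ := persist_cost_basic hW hγ hG
  have hEs : ∀ u v, E u v = E v u := fun u v => by rw [hE, hE, hGs]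
  have hσl0 : 0 ≤ σ * lam := mul_nonneg hσ0 hlam0
  wlog hWab : W a ≤ W b generalizing a b s t
  · rw [persist_debt_symm hGs hEs, hEs a b]
    exact this (Ne.symm hab) t s (le_of_not_ge hWab)
  obtain ⟨hα0, hα1⟩ := persist_acc_mem hW hacc a s
  obtain ⟨hβ0, hβ1⟩ := persist_acc_mem hW hacc b t
  have hi := persist_accept_mul_cost_le_left hW hacc hγ hG hab hWab s
  have hii := persist_accept_mul_cost_le_right hW hacc hγ hG hab hWab t
  have hg : G a b = γ * W b := by rw [hGne a b hab, max_eq_right hWab]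
  simp only [hE]
  -- the main part is `≤ G(a,b)`, the `σλ`-part is `≤ 2σλ·G(a,b)`
  rcases le_total (acc a s) (acc b t) with hm | hm
  · -- `min = α`
    rw [min_eq_left hm]
    have hαg : 0 ≤ (1 - acc a s) * G a b := mul_nonneg (sub_nonneg.mpr hα1) (hG0 a b)
    have hc : 0 ≤ acc b t - σ * lam * acc a s := by nlinarith [mul_le_mul hσl1 hm (hα0) zero_le_one]
    have main : acc a s * G a b + (acc b t - acc a s) * G s b - (acc b t - σ * lam * acc a s) * G s t ≤ G a b := by
      rcases le_or_gt (W s) (W b) with hsb | hsb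
      · -- `G(s,b) ≤ G(a,b)`
        have h1 : G s b ≤ G a b := by
          by_cases e : s = b
          · rw [e, hGd]; exact hG0 _ _
          · rw [hGne s b e, max_eq_right hsb, hg]
        have h2 : 0 ≤ (acc b t - σ * lam * acc a s) * G s t := mul_nonneg hc (hG0 s t)
        have h3 := mul_le_mul_of_nonneg_left h1 (sub_nonneg.mpr hm)
        have hβg : 0 ≤ (1 - acc b t) * G a b := mul_nonneg (sub_nonneg.mpr hβ1) (hG0 a b)
        nlinarith
      · -- `W s > W b`: `G(s,b) = γ W s`, `α = W a/W s`
        have hsb' : s ≠ b := fun e => by rw [e] at hsb; exact lt_irrefl _ hsb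
        have hGsb : G s b = γ * W s := by rw [hGne s b hsb', max_eq_left hsb.le]
        have hαe : acc a s = W a / W s := persist_acc_eq_div hW hacc (hWab.trans hsb.le)
        have hs0 : W s ≠ 0 := (hW s).ne'
        by_cases hst : s = t
        · subst hst
          have hβe : acc b s = W b / W s := persist_acc_eq_div hW hacc hsb.le
          rw [hGd, mul_zero, sub_zero, hGsb, hg, hαe, hβe]
          have e1 : W a / W s * (γ * W b) + (W b / W s - W a / W s) * (γ * W s) = γ * W b + γ * W a * (W b / W s - 1) := by
            field_simp; ring
          rw [e1]
          have : W b / W s - 1 ≤ 0 := by rw [sub_nonpos, div_le_one (hW s)]; exact hsb.le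
          nlinarith [mul_nonneg hγ.le (hW a).le]
        · have hGst : γ * W s ≤ G s t := by rw [hGne s t hst]; exact mul_le_mul_of_nonneg_left (le_max_left _ _) hγ.le
          have h4 := mul_le_mul_of_nonneg_left hGst hc
          have h5 : 0 ≤ acc a s * (γ * W s) * (1 - σ * lam) := mul_nonneg (mul_nonneg hα0 (mul_nonneg hγ.le (hW s).le)) (sub_nonneg.mpr hσl1)
          rw [hGsb]
          nlinarith
    have tail : (acc b t - acc a s) * G a t + (1 - acc b t) * G a b ≤ 2 * G a b := by
      nlinarith [mul_nonneg hα0 (hG0 a t), hG0 a b, mul_nonneg hβ0 (hG0 a b)]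
    nlinarith [mul_le_mul_of_nonneg_left tail hσl0, hG0 a b]
  · -- `min = β`
    rw [min_eq_right hm]
    have hβg : 0 ≤ (1 - acc b t) * G a b := mul_nonneg (sub_nonneg.mpr hβ1) (hG0 a b)
    have hc : 0 ≤ acc a s - σ * lam * acc b t := by nlinarith [mul_le_mul hσl1 hm hβ0 zero_le_one]
    have main : acc b t * G a b + (acc a s - acc b t) * G a t - (acc a s - σ * lam * acc b t) * G s t ≤ G a b := by
      rcases le_or_gt (W t) (W b) with htb | htb
      · have h1 : G a t ≤ G a b := by
          by_cases e : a = t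
          · rw [e, hGd]; exact hG0 _ _
          · rw [hGne a t e, hg]; exact mul_le_mul_of_nonneg_left (max_le hWab htb) hγ.le
        have h2 : 0 ≤ (acc a s - σ * lam * acc b t) * G s t := mul_nonneg hc (hG0 s t)
        have h3 := mul_le_mul_of_nonneg_left h1 (sub_nonneg.mpr hm)
        have hαg : 0 ≤ (1 - acc a s) * G a b := mul_nonneg (sub_nonneg.mpr hα1) (hG0 a b)
        nlinarith
      · have hat : a ≠ t := fun e => by rw [← e] at htb; exact absurd (hWab.trans_lt htb) (lt_irrefl _)
        have hGat : G a t = γ * W t := by rw [hGne a t hat, max_eq_right (hWab.trans htb.le)]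
        have hβe : acc b t = W b / W t := persist_acc_eq_div hW hacc htb.le
        by_cases hst : s = t
        · subst hst
          -- then `α = W a/W s ≤ β`, so `α = β`
          have hαe : acc a s = W a / W s := persist_acc_eq_div hW hacc (hWab.trans htb.le)
          have hαβ : acc a s ≤ acc b s := by rw [hαe, hβe]; exact div_le_div_of_nonneg_right hWab (hW s).le
          have heq : acc a s = acc b s := le_antisymm hαβ hm
          rw [heq, sub_self, zero_mul, add_zero, hGd, mul_zero, sub_zero]
          nlinarith [hG0 a b]
        · have hGst : γ * W t ≤ G s t := by rw [hGne s t hst]; exact mul_le_mul_of_nonneg_left (le_max_right _ _) hγ.le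
          have h4 := mul_le_mul_of_nonneg_left hGst hc
          have h5 : 0 ≤ acc b t * (γ * W t) * (1 - σ * lam) := mul_nonneg (mul_nonneg hβ0 (mul_nonneg hγ.le (hW t).le)) (sub_nonneg.mpr hσl1)
          rw [hGat]
          nlinarith
    have tail : (acc a s - acc b t) * G s b + (1 - acc a s) * G a b ≤ 2 * G a b := by
      nlinarith [mul_nonneg hβ0 (hG0 s b), hG0 a b, mul_nonneg hα0 (hG0 a b)]
    nlinarith [mul_le_mul_of_nonneg_left tail hσl0, hG0 a b]

/-! ## §4 (R): the averaged healing credit after a shared redraw -/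

/-- **(R) HUB DOMINATION:** with `μ_0·W = μ_1` (so `W = μ_1/μ_0`), `Σ μ_1 = 1`, `μ_0 ≥ 0` and `p·W ≤ 1`, the fresh hub content heals a disagreeing level of type `(u,v)` in both
copies with mean probability `Σ_z μ_0(z)·min{acc(z,u),acc(z,v)} ≥ p`; hence `Σ_z μ_0(z)·net(z;u,v) ≥ (1 − 2σλ)·p·G(u,v)`. [ours] -/
theorem persist_redraw_ge [Fintype S] (hW : ∀ u, 0 < W u) (hacc : ∀ x u, acc x u = min 1 (W x / W u)) (hγ : 0 < γ)
    (hG : ∀ u v, G u v = if u = v then 0 else γ * max (W u) (W v)) (hE : ∀ u v, E u v = lam * G u v) (hσ0 : 0 ≤ σ) (hlam0 : 0 ≤ lam)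
    (hσl : σ * lam ≤ 1 / 2)
    (hnet : ∀ z u v, net z u v = min (acc z u) (acc z v) * (G u v - σ * E u v)
      - (acc z u - min (acc z u) (acc z v)) * (G z v - G u v + σ * E u z) - (acc z v - min (acc z u) (acc z v)) * (G u z - G u v + σ * E z v))
    {μ0 μ1 : S → ℝ} {p : ℝ} (hμ0 : ∀ z, 0 ≤ μ0 z) (hμW : ∀ z, μ0 z * W z = μ1 z) (hμ1 : ∑ z, μ1 z = 1) (hpW : ∀ z, p * W z ≤ 1)
    (u v : S) : (1 - 2 * (σ * lam)) * p * G u v ≤ ∑ z, μ0 z * net z u v := by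
  obtain ⟨hG0, _, _, _, _⟩ := persist_cost_basic hW hγ hG
  have hk : 0 ≤ 1 - 2 * (σ * lam) := by linarith
  -- `min{acc(z,u), acc(z,v)} ≥ p·W z`
  have hmin : ∀ z, p * W z ≤ min (acc z u) (acc z v) := by
    intro z
    have key : ∀ x, p * W z ≤ acc z x := by
      intro x
      rw [hacc]
      refine le_min (hpW z) ?_
      rw [le_div_iff₀ (hW x)]
      calc p * W z * W x = (p * W x) * W z := by ring
        _ ≤ 1 * W z := mul_le_mul_of_nonneg_right (hpW x) (hW z).le
        _ = W z := one_mul _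
    exact le_min (key u) (key v)
  calc (1 - 2 * (σ * lam)) * p * G u v = ∑ z, μ1 z * ((1 - 2 * (σ * lam)) * p * G u v) := by rw [← Finset.sum_mul, hμ1, one_mul]
    _ = ∑ z, μ0 z * ((1 - 2 * (σ * lam)) * G u v * (p * W z)) := sum_congr rfl fun z _ => by rw [← hμW z]; ring
    _ ≤ ∑ z, μ0 z * ((1 - 2 * (σ * lam)) * G u v * min (acc z u) (acc z v)) :=
        sum_le_sum fun z _ => mul_le_mul_of_nonneg_left (mul_le_mul_of_nonneg_left (hmin z) (mul_nonneg hk (hG0 u v))) (hμ0 z)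
    _ ≤ ∑ z, μ0 z * net z u v := sum_le_sum fun z _ => mul_le_mul_of_nonneg_left (persist_net_ge hW hacc hγ hG hE hσ0 hlam0 hnet z u v) (hμ0 z)

end Weights

end Summit.Ventures.LatticeQCDFlow.Scaling

end
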